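import Summits.Ventures.Crystal3D.TopCut.X2D8u060Agg1

/-!
# X2 cap cut `X2D8u060` (u₀ = -3/5, degrees (d, d_X) = (8, 8)): kernel validation of the pole expansions (part 1)

HONEST FRAMING: generated data / kernel-validation file of the venture `Crystal3D` (cell `pub-crystal3d`, phase 2,
seat p2): one piece of the kernel replay of an EXACT pole-augmented («X2») Bachoc–Vallentin cap certificate on `S²`
(format `Bulk/CapX2Cert.X2Cert` of seat p1; cap level u₀ = -3/5, inner products ≤ 1/2) solved directly in
sum-of-squares form (`capx2sos.py` + `exactx2.py`: CLARABEL float solve → exact rounding → integer identities; certificate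
`x2sos_d8_dX8_u3over5`, bound value 11.998839 < 12) and checked through `TopCut/X2SOSExpand.lean` + `X2SOSCheck.lean` +
`X2SOSSound.lean` (generic checker + soundness), `TopCut/CapSOSCheck.lean` and the tree's `ThreePointCert.CheckKron`.
Nothing geometric is proved in this file; plain lists of integers / rationals / monomials and `decide +kernel` facts about
them (standard axioms only, no `native_decide`).
-/

namespace Summit.Ventures.Crystal3D.TopCut.X2D8u060

open Literature.Geometry.DiscreteGeometry Literature.Geometry.DiscreteGeometry.PolyCert PolyCert.SPoly
open Literature.Geometry.DiscreteGeometry.BachocVallentin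
open Summit.Ventures.PackingBounds.ThreePointCert Summit.Ventures.Crystal3D.CapSOS Summit.Ventures.Crystal3D.CapX2 Summit.Ventures.Crystal3D.X2SOS

set_option maxRecDepth 100000 in
set_option maxHeartbeats 0 in
/-- Pole pair expansion `PI`, blocks k ∈ [0, 1, 2] (kernel). [folklore] -/
theorem okP_1 : pieceOK (polePPoly [X2D8u060.pblk0, X2D8u060.pblk1, X2D8u060.pblk2]) [] X2D8u060.dPc1 = true := by
  decide +kernel

set_option maxRecDepth 100000 in
set_option maxHeartbeats 0 in
/-- Triple expansion `SI`, blocks k ∈ [0, 1, 2] (kernel). [folklore] -/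
theorem okS_1 : pieceOK (poleSPoly [X2D8u060.pblk0, X2D8u060.pblk1, X2D8u060.pblk2]) [] X2D8u060.dSc1 = true := by
  decide +kernel

set_option maxRecDepth 100000 in
set_option maxHeartbeats 0 in
/-- Pole pair expansion `PI`, blocks k ∈ [3, 4, 5] (kernel). [folklore] -/
theorem okP_2 : pieceOK (polePPoly [X2D8u060.pblk3, X2D8u060.pblk4, X2D8u060.pblk5]) X2D8u060.dPc1 X2D8u060.dPc2 = true := by
  decide +kernel

set_option maxRecDepth 100000 in
set_option maxHeartbeats 0 in
/-- Triple expansion `SI`, blocks k ∈ [3, 4, 5] (kernel). [folklore] -/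
theorem okS_2 : pieceOK (poleSPoly [X2D8u060.pblk3, X2D8u060.pblk4, X2D8u060.pblk5]) X2D8u060.dSc1 X2D8u060.dSc2 = true := by
  decide +kernel

end Summit.Ventures.Crystal3D.TopCut.X2D8u060
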